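import Summits.NavierStokesRegularity.NavierStokesRegularity.Theorems.StrainDoorsSliceBounds
import HarnessLib

/-!
# Strain doors, PART M §M31(d) — LINK 2 PROVED: `slicedLinearLEIUnderRate_holds`

ROUND 70 of the `ns-regularity-ideate` programme (p1 line; helper lane of `stmt-NavierStokesRegularity-0056`,
rung N0; nothing here is a claim about Navier–Stokes regularity).  ROUND 69 proved door X′ (the `L²`-Morrey Type-I
bound from the sup-norm rate IN THE ENERGY CLASS, constant `M₂(M, ‖u₀‖₂, T₀)`) and typed door X″
`UlocMorreyBoundSupTypeI`: the same bound with an `M`-ONLY constant at all radii `r² < T`.  ROUND 70 CLOSES X″ by a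
uniformly-local energy Grönwall argument under the rate, in three links, ALL PROVED: LINK 1 (the pressure pairing of
the local energy inequality is LINEAR in the local energies under a sup bound, `M`-free constants — texts N11a/N11b),
LINK 2 (the sliced local energy inequality under the rate at unit scale is linear with `M`-only data — typed in N11c,
PROVED in N11e/N11f/N11g), LINK 3 (LINK 2 ⇒ X″ by Grönwall and Leray rescaling — N11c); N11d puts them together:
`ulocMorreyBoundSupTypeI_holds : UlocMorreyBoundSupTypeI`.

THIS FILE (imports N11f; tree `SereginSverakLocalEnergy`, `SereginSverakPressureProofs`, `LerayHopfSpatialGradient`):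
* `suitableData_of_classical` — the suitable-weak data of a classical Leray–Hopf solution on the slab `(0,T) × ℝ³`
  (weak gradient from `IsLerayHopfOn.exists_hasWeakSpatialGradientOn`, local energy identity
  `SereginSverak2002.isSuitableWeakSolutionOn_of_classical`);
* `integrableOn_localEnergyRHS_winCutoffAt` — integrability of `R[ζ_{T,y}]` on `{s' < s} × ℝ³` for `s < T` (the
  time-level cut-off trick: replace `ζ` by a test function of the open slab `(0, s + 3δ)`, `4δ = T − s`, which agrees
  with `ζ` below `s + δ`);
* `ofReal_integral_localEnergyRHS_le` ★ — Fubini on the SIGNED right-hand side (the pressure cancellation of §M31(c)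
  is invisible after taking absolute values) and the a.e. slice bound `sliceRHS_le` (gauge identity a.e. in time,
  `SereginSverak2002.exists_pressure_gauge_of_classical`): `ofReal ∫_{s'<s} R[ζ] ≤ ∫⁻_{T−1}^{s} (W₁ + W₂ ofReal(M/√(T−σ))) ulocEnergy(u σ) dσ`;
* `le_of_ae_le_of_continuousOn`, `continuousOn_setLIntegral_ball` — the every-time upgrade;
* ★★★ `slicedLinearLEIUnderRate_holds : SlicedLinearLEIUnderRate` with `A = 2|B_1|`, `B₁ = linkWeight₁ M_ζ`,
  `B₂ = linkWeight₂ M_ζ C₁ C₂` (absolute): trivial regime `t ≤ T − 1/2` from the rate, LEI regime `t > T − 1/2` from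
  `IsSuitableWeakSolutionOn.ae_localEnergy_slice_ennreal_of_forall_lt` with `ζ_{T,y}` (`= 1` on the slice ball since
  `t ≥ T − 1/2`), then the two steps above.
No definitions, no `sorry`, no new axioms, no instances, no notation.
-/

noncomputable section

set_option linter.dupNamespace false

open MeasureTheory Set Function Filter Metric Real
open _root_.Topology
open scoped ENNReal NNReal RealInnerProductSpace Laplacian
open Literature.Analysis Literature.Analysis.FluidPDE

namespace Summit.NavierStokesRegularity.NavierStokesRegularity.Theorems.StrainDoors

/-! ### §M31(d) Fubini on the signed right-hand side, the every-time upgrade: LINK 2 PROVED -/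

/-- Ball / closed ball differ by a Lebesgue-null sphere. [folklore] -/
theorem ball_ae_eq_closedBall_volume (x : EuclideanSpace ℝ (Fin 3)) (r : ℝ) :
    ball x r =ᵐ[volume] closedBall x r := by
  refine ae_eq_set.2 ⟨?_, ?_⟩
  · rw [sdiff_eq_empty.2 ball_subset_closedBall]; exact measure_empty
  · rw [closedBall_sdiff_ball]; exact Measure.addHaar_sphere volume x r

/-- The suitable-weak-solution data of a classical solution on the open slab `(0, T) × ℝ³`
(ungauged pressure: the local energy identity holds for any pressure solving the system).
[cite: SereginSverak2002, §2 p. 94] -/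
theorem suitableData_of_classical {T : ℝ} {u : ℝ → EuclideanSpace ℝ (Fin 3) → EuclideanSpace ℝ (Fin 3)}
    {p : ℝ → EuclideanSpace ℝ (Fin 3) → ℝ} (hcl : IsClassicalNSSolutionOn (Ico 0 T) 1 0 u p) :
    IsSuitableWeakSolutionOn (slab (EuclideanSpace ℝ (Fin 3)) (Ioo 0 T) isOpen_Ioo) 1 0 u p ∧
    LocallyIntegrableOn (fun z : ℝ × EuclideanSpace ℝ (Fin 3) => ‖u z.1 z.2‖ ^ 3)
      ((slab (EuclideanSpace ℝ (Fin 3)) (Ioo 0 T) isOpen_Ioo : TopologicalSpace.Opens _) :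
        Set (ℝ × EuclideanSpace ℝ (Fin 3))) volume ∧
    LocallyIntegrableOn (fun z : ℝ × EuclideanSpace ℝ (Fin 3) =>
      ⟪(0 : ℝ → EuclideanSpace ℝ (Fin 3) → EuclideanSpace ℝ (Fin 3)) z.1 z.2, u z.1 z.2⟫)
      ((slab (EuclideanSpace ℝ (Fin 3)) (Ioo 0 T) isOpen_Ioo : TopologicalSpace.Opens _) :
        Set (ℝ × EuclideanSpace ℝ (Fin 3))) volume := by
  have hQ : ((slab (EuclideanSpace ℝ (Fin 3)) (Ioo 0 T) isOpen_Ioo : TopologicalSpace.Opens _) :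
      Set (ℝ × EuclideanSpace ℝ (Fin 3))) = Ioo 0 T ×ˢ univ := coe_slab _ _
  refine ⟨SereginSverak2002.isSuitableWeakSolutionOn_of_classical hcl _ hQ.le, ?_, ?_⟩
  · rw [hQ]
    refine ContinuousOn.locallyIntegrableOn ?_ (measurableSet_Ioo.prod MeasurableSet.univ)
    exact ((hcl.smooth_velocity.continuousOn.mono (prod_mono Ioo_subset_Ico_self le_rfl)).norm).pow 3
  · have e : (fun z : ℝ × EuclideanSpace ℝ (Fin 3) =>
        ⟪(0 : ℝ → EuclideanSpace ℝ (Fin 3) → EuclideanSpace ℝ (Fin 3)) z.1 z.2, u z.1 z.2⟫) =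
        fun _ => (0 : ℝ) := by
      funext z; simp
    rw [e]
    exact locallyIntegrableOn_const (0 : ℝ)

/-- The local-energy right-hand side against the window cut-off is integrable on every half-space
`{s' < s}`, `s < T` (time-level cut-off trick: `θζ` is a test function on the slab and
`R[θζ] = R[ζ]` below `s`). [folklore] -/
theorem integrableOn_localEnergyRHS_winCutoffAt {T : ℝ} (hT : 1 < T)
    {u : ℝ → EuclideanSpace ℝ (Fin 3) → EuclideanSpace ℝ (Fin 3)} {p : ℝ → EuclideanSpace ℝ (Fin 3) → ℝ}
    (hcl : IsClassicalNSSolutionOn (Ico 0 T) 1 0 u p) (y : EuclideanSpace ℝ (Fin 3)) {s : ℝ} (hs : s < T) :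
    IntegrableOn (localEnergyRHS 1 0 u p (winCutoffAt T y)) {z : ℝ × EuclideanSpace ℝ (Fin 3) | z.1 < s}
      volume := by
  obtain ⟨hsw, hu3, hfu⟩ := suitableData_of_classical hcl
  have hζ := isSpaceTimeTestOn_winCutoffAt T y
  have hζQ : ∀ τ < T, tsupport (uncurry (winCutoffAt T y)) ∩ {z | z.1 ≤ τ} ⊆
      ((slab (EuclideanSpace ℝ (Fin 3)) (Ioo 0 T) isOpen_Ioo : TopologicalSpace.Opens _) :
        Set (ℝ × EuclideanSpace ℝ (Fin 3))) := by
    intro τ hτ z hz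
    rw [coe_slab]
    have h1 := (tsupport_winCutoffAt_subset T y hz.1).1
    have h2 : z.1 ≤ τ := hz.2
    exact ⟨⟨by linarith, by linarith⟩, mem_univ _⟩
  have hδ0 : 0 < (T - s) / 4 := by linarith
  obtain ⟨θ, ρ, hθs, hθd, hθ1, hθ0, hρ0, -⟩ := exists_time_level_cutoff (s + 3 * ((T - s) / 4)) hδ0
  have hζθ := hζ.time_mul_of_forall_lt hζQ hθs (a := s + 3 * ((T - s) / 4) - (T - s) / 4) (by linarith)
    (fun t ht => hθ0 t ht)
  have hint := hsw.integrable_localEnergyRHS hu3 hfu hζθ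
  refine hint.integrableOn.congr_fun (fun z hz => ?_) (measurableSet_lt measurable_fst measurable_const)
  have hz' : z.1 < s := hz
  rw [show z = (z.1, z.2) from rfl, localEnergyRHS_mul_of_hasDerivAt hζ hθd,
    hθ1 _ (by linarith), hρ0 _ (by linarith)]
  ring

/-- **The Grönwall-shaped bound of the right-hand side** (every `s < T`): by Fubini and the slice
bound at almost every time (the pressure gauge holds a.e.), with the slices vanishing before
`T − 1`. [cite: CKN1982, §2 (2.13) p. 779] -/
theorem ofReal_integral_localEnergyRHS_le {Mz : ℝ}
    (hM : (∀ s x, |timeDeriv winCutoff s x| ≤ Mz) ∧ (∀ s x, |(Δ (winCutoff s)) x| ≤ Mz) ∧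
      (∀ s x, ‖gradient (winCutoff s) x‖ ≤ Mz))
    {C₁ C₂ : ℝ≥0∞}
    (hP : ∀ {w g : EuclideanSpace ℝ (Fin 3) → EuclideanSpace ℝ (Fin 3)} {x₀ : EuclideanSpace ℝ (Fin 3)}
      {Kb Cg : ℝ} {α : ℝ≥0∞}, 0 ≤ Kb → 0 ≤ Cg → AEStronglyMeasurable w volume →
      Integrable (fun y => ‖w y‖ ^ 2) volume → MemLp (fun y => ‖w y‖ ^ 2) (3 / 2 : ℝ≥0∞) volume →
      (∀ y ∈ ball x₀ (2 * 3), ‖w y‖ ≤ Kb) → (∀ z, ∫⁻ y in ball z 1, ‖w y‖ₑ ^ 2 ≤ α) →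
      AEStronglyMeasurable g volume → (∀ x, ‖g x‖ ≤ Cg) → (∀ x ∉ ball x₀ 3, g x = 0) →
      ∫ x, ⟪w x, g x⟫ = 0 →
      ‖∫ x, normalisedPressure w x * ⟪w x, g x⟫‖ₑ ≤
        ENNReal.ofReal (Kb * Cg) * (C₁ * (∫⁻ y in ball x₀ (2 * 3), ‖w y‖ₑ ^ 2) + C₂ * α))
    {M T : ℝ} (hM0 : 0 ≤ M) (hT : 1 < T)
    {u : ℝ → EuclideanSpace ℝ (Fin 3) → EuclideanSpace ℝ (Fin 3)} {p : ℝ → EuclideanSpace ℝ (Fin 3) → ℝ}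
    (hcl : IsClassicalNSSolutionOn (Ico 0 T) 1 0 u p) (hLH : IsLerayHopfOn T 1 0 (u 0) u)
    (hrate : ∀ t ∈ Ioo 0 T, ∀ x, ‖u t x‖ ≤ M / Real.sqrt (T - t))
    (y : EuclideanSpace ℝ (Fin 3)) {s : ℝ} (hs : s < T) :
    ENNReal.ofReal (∫ z in {z : ℝ × EuclideanSpace ℝ (Fin 3) | z.1 < s},
        localEnergyRHS 1 0 u p (winCutoffAt T y) z) ≤
      ∫⁻ σ in Ioo (T - 1) s, (linkWeight₁ Mz + linkWeight₂ Mz C₁ C₂ * ENNReal.ofReal (M / Real.sqrt (T - σ))) *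
        ulocEnergy (u σ) := by
  -- Landing edit (hand ns-s29-p2 g7; gate `dedup.landed` on the planner's top-level helper
  -- `ofReal_integral_le_lintegral_ofReal_any` ≡ `Literature.MathematicalPhysics.KineticTheory.ofReal_integral_le_lintegral`,
  -- whose import cone is foreign to this file): the helper is inlined as a local `have`; all statements unchanged.
  have ofReal_integral_le_lintegral_ofReal_any : ∀ g : ℝ → ℝ,
      ENNReal.ofReal (∫ σ in Iio s, g σ) ≤ ∫⁻ σ in Iio s, ENNReal.ofReal (g σ) := fun g => by
    by_cases hgi : Integrable g (volume.restrict (Iio s))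
    · calc ENNReal.ofReal (∫ σ in Iio s, g σ) ≤ ENNReal.ofReal (∫ σ in Iio s, max (g σ) 0) :=
            ENNReal.ofReal_le_ofReal (integral_mono hgi hgi.pos_part fun x => le_max_left _ _)
        _ = ∫⁻ σ in Iio s, ENNReal.ofReal (max (g σ) 0) :=
            ofReal_integral_eq_lintegral_ofReal hgi.pos_part (Eventually.of_forall fun x => le_max_right _ _)
        _ = ∫⁻ σ in Iio s, ENNReal.ofReal (g σ) := lintegral_congr fun x => by
            rcases le_total (g x) 0 with hx | hx
            · rw [max_eq_right hx, ENNReal.ofReal_zero, ENNReal.ofReal_of_nonpos hx]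
            · rw [max_eq_left hx]
    · rw [integral_undef hgi, ENNReal.ofReal_zero]; exact bot_le
  have hT0 : 0 < T := by linarith
  have hIO := integrableOn_localEnergyRHS_winCutoffAt hT hcl y hs
  -- Fubini
  have hset : {z : ℝ × EuclideanSpace ℝ (Fin 3) | z.1 < s} = Iio s ×ˢ univ := by
    ext z; simp
  have hμ : (volume : Measure (ℝ × EuclideanSpace ℝ (Fin 3))).restrict (Iio s ×ˢ univ) =
      ((volume : Measure ℝ).restrict (Iio s)).prod (volume : Measure (EuclideanSpace ℝ (Fin 3))) := by
    rw [Measure.volume_eq_prod, ← Measure.prod_restrict, Measure.restrict_univ]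
  have hI' : Integrable (localEnergyRHS 1 0 u p (winCutoffAt T y)) (((volume : Measure ℝ).restrict (Iio s)).prod
      (volume : Measure (EuclideanSpace ℝ (Fin 3)))) := by
    rw [← hμ, ← hset]; exact hIO
  have hfub : ∫ z in {z : ℝ × EuclideanSpace ℝ (Fin 3) | z.1 < s}, localEnergyRHS 1 0 u p (winCutoffAt T y) z =
      ∫ σ in Iio s, ∫ x, localEnergyRHS 1 0 u p (winCutoffAt T y) (σ, x) := by
    rw [hset, hμ, integral_prod _ hI']
  rw [hfub]
  -- the a.e. slice bound
  obtain ⟨hgauge, -⟩ := SereginSverak2002.exists_pressure_gauge_of_classical one_pos hT0 hcl hLH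
  have hg' := (ae_restrict_iff' measurableSet_Ioo).1 hgauge
  have hne : ∀ᵐ σ ∂(volume : Measure ℝ), σ ∉ ({T - 1} : Set ℝ) :=
    measure_eq_zero_iff_ae_notMem.1 (measure_singleton _)
  have hae : ∀ᵐ σ ∂((volume : Measure ℝ).restrict (Iio s)),
      ENNReal.ofReal (∫ x, localEnergyRHS 1 0 u p (winCutoffAt T y) (σ, x)) ≤ (Ioo (T - 1) s).indicator (fun σ =>
        (linkWeight₁ Mz + linkWeight₂ Mz C₁ C₂ * ENNReal.ofReal (M / Real.sqrt (T - σ))) * ulocEnergy (u σ)) σ := by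
    filter_upwards [ae_restrict_of_ae hg', ae_restrict_of_ae hne,
      ae_restrict_mem measurableSet_Iio] with σ hσg hσne hσs
    have hσs' : σ < s := hσs
    rcases lt_or_gt_of_ne (fun h => hσne (mem_singleton_iff.2 h)) with hlt | hgt
    · -- before the window: the slice vanishes
      have h0 : ∀ x, localEnergyRHS 1 0 u p (winCutoffAt T y) (σ, x) = 0 := fun x => by
        obtain ⟨-, h2, h3, h4⟩ := winCutoffAt_weights_eq_zero (T := T) (y := y) (s := σ) (x := x) (Or.inl hlt)
        rw [localEnergyRHS_apply]
        dsimp only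
        rw [h2, h3, h4]
        simp
      simp [h0]
    · rw [indicator_of_mem (show σ ∈ Ioo (T - 1) s from ⟨hgt, hσs'⟩)]
      have hσ0 : 0 < σ := by linarith
      have hσT : σ < T := hσs'.trans hs
      have hgx := hσg ⟨hσ0, hσT⟩
      have hKb : 0 ≤ M / Real.sqrt (T - σ) := div_nonneg hM0 (Real.sqrt_nonneg _)
      exact sliceRHS_le hM hP hKb
        (((hcl.smooth_velocity.contDiff_slice ⟨hσ0.le, hσT⟩).of_le (by exact_mod_cast le_top)))
        (hcl.divFree σ ⟨hσ0.le, hσT⟩) (hLH.memLp σ ⟨hσ0.le, hσT.le⟩) (hrate σ ⟨hσ0, hσT⟩)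
        ((hcl.smooth_pressure.contDiff_slice ⟨hσ0.le, hσT⟩).continuous)
        (c := p σ 0 - normalisedPressure (u σ) 0) (fun x => by linarith [hgx x])
  calc ENNReal.ofReal (∫ σ in Iio s, ∫ x, localEnergyRHS 1 0 u p (winCutoffAt T y) (σ, x))
      ≤ ∫⁻ σ in Iio s, ENNReal.ofReal (∫ x, localEnergyRHS 1 0 u p (winCutoffAt T y) (σ, x)) :=
        ofReal_integral_le_lintegral_ofReal_any _
    _ ≤ ∫⁻ σ in Iio s, (Ioo (T - 1) s).indicator (fun σ => (linkWeight₁ Mz + linkWeight₂ Mz C₁ C₂ * ENNReal.ofReal (M / Real.sqrt (T - σ))) * ulocEnergy (u σ)) σ := lintegral_mono_ae hae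
    _ = ∫⁻ σ in Ioo (T - 1) s, (linkWeight₁ Mz + linkWeight₂ Mz C₁ C₂ * ENNReal.ofReal (M / Real.sqrt (T - σ))) * ulocEnergy (u σ) := by
        rw [lintegral_indicator measurableSet_Ioo, Measure.restrict_restrict measurableSet_Ioo,
          inter_eq_left.2 Ioo_subset_Iio_self]

/-- **Every-time upgrade**: an a.e. inequality `F ≤ G` on `(a, t)` with `F` continuous on `[a, t]`
and `G` monotone holds at `t`. [folklore] -/
theorem le_of_ae_le_of_continuousOn {F G : ℝ → ℝ≥0∞} {a t : ℝ} (hat : a < t)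
    (hF : ContinuousOn F (Icc a t)) (hG : Monotone G) (hae : ∀ᵐ s ∂(volume : Measure ℝ), s ∈ Ioo a t → F s ≤ G s) :
    F t ≤ G t := by
  by_contra h
  rw [not_le] at h
  have hFt : ContinuousWithinAt F (Icc a t) t := hF t ⟨hat.le, le_rfl⟩
  have hev : ∀ᶠ s in 𝓝[Icc a t] t, G t < F s := hFt.eventually (lt_mem_nhds h)
  rw [eventually_nhdsWithin_iff, Metric.eventually_nhds_iff] at hev
  obtain ⟨δ, hδ, hδP⟩ := hev
  obtain ⟨a', ha'⟩ : ∃ a' : ℝ, a' = max a (t - δ / 2) := ⟨_, rfl⟩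
  have ha'1 : a ≤ a' := ha' ▸ le_max_left _ _
  have ha'2 : t - δ / 2 ≤ a' := ha' ▸ le_max_right _ _
  have ha't : a' < t := ha' ▸ max_lt hat (by linarith)
  haveI : NeZero ((volume : Measure ℝ).restrict (Ioo a' t)) := ⟨fun h0 => by
    rw [Measure.restrict_eq_zero, Real.volume_Ioo] at h0
    exact absurd h0 (ENNReal.ofReal_pos.2 (by linarith)).ne'⟩
  obtain ⟨s, hs, hsI⟩ := ((ae_restrict_of_ae (μ := volume) (s := Ioo a' t) hae).and
    (ae_restrict_mem measurableSet_Ioo)).exists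
  have hsa : a < s := lt_of_le_of_lt ha'1 hsI.1
  have hst : s < t := hsI.2
  have hs2 : t - δ / 2 < s := lt_of_le_of_lt ha'2 hsI.1
  have h1 : G t < F s := hδP (by rw [Real.dist_eq, abs_lt]; constructor <;> linarith) ⟨hsa.le, hst.le⟩
  have h2 : F s ≤ G s := hs ⟨hsa, hst⟩
  exact absurd ((h1.trans_le h2).trans_le (hG hst.le)) (lt_irrefl _)

/-- Continuity of `t ↦ ∫⁻_{B(y,1)} |u(t)|²` on compact subintervals of `[0, T)` for a classical
velocity field. [folklore] -/
theorem continuousOn_setLIntegral_ball {T : ℝ} {u : ℝ → EuclideanSpace ℝ (Fin 3) → EuclideanSpace ℝ (Fin 3)}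
    (hu : IsSmoothSpaceTimeOn (Ico 0 T) u) {a b : ℝ} (ha : 0 ≤ a) (hab : a ≤ b) (hb : b < T)
    (y : EuclideanSpace ℝ (Fin 3)) :
    ContinuousOn (fun t => ∫⁻ x in ball y 1, ‖u t x‖ₑ ^ 2) (Icc a b) := by
  have hsub : Icc a b ×ˢ (univ : Set (EuclideanSpace ℝ (Fin 3))) ⊆ Ico 0 T ×ˢ univ :=
    prod_mono (fun t ht => ⟨ha.trans ht.1, ht.2.trans_lt hb⟩) le_rfl
  have hcont := continuousOn_ballEnergy hab (hu.continuousOn.mono hsub) y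
  refine (ENNReal.continuous_ofReal.comp_continuousOn hcont).congr fun t ht => ?_
  have htI : t ∈ Ico 0 T := ⟨ha.trans ht.1, ht.2.trans_lt hb⟩
  have hc : Continuous (u t) := (hu.contDiff_slice htI).continuous
  have hint : IntegrableOn (fun x => ‖u t x‖ ^ 2) (closedBall y 1) volume :=
    ((hc.norm.pow 2).continuousOn).integrableOn_compact (isCompact_closedBall y 1)
  simp only [Function.comp_apply]
  rw [setLIntegral_congr (ball_ae_eq_closedBall_volume y 1),
    ofReal_integral_eq_lintegral_ofReal hint (ae_of_all _ fun x => sq_nonneg _)]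
  refine lintegral_congr fun x => ?_
  rw [← ofReal_norm, ← ENNReal.ofReal_pow (norm_nonneg _)]

/-- **LINK 2 PROVED: the sliced linear local energy inequality under the sup-Type-I rate.**
Constants: `A = 2|B₁|`, `B₁ = linkWeight₁ M_Z`, `B₂ = linkWeight₂ M_Z C₁ C₂` with `M_Z` the
derivative bound of the window cut-off and `C₁, C₂` the constants of the linear pressure pairing
§M29(c) at `r = 3`.  Proof: on `[T − 1, T − 1/2]` the rate alone gives `∫_{B(y,1)}|u(t)|² ≤ 2M²|B₁|`;
on `(T − 1/2, T)` the local energy inequality of the classical (hence suitable) solution against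
the window cut-off `ζ_{T,y}` (`= 1` on `[T − 1/2, T] × B(y,1)`, supported in
`(T − 1, T + 1) × B(y, 2)`) bounds `∫_{B(y,1)}|u(s)|²` for a.e. `s` by `∫_{s' < s} R[ζ]`, which
`ofReal_integral_localEnergyRHS_le` bounds by the Grönwall integral; the every-time statement
follows from the continuity of `t ↦ ∫_{B(y,1)}|u(t)|²` and the monotonicity of the bound.
[cite: CKN1982, §2 (2.13) p. 779; SereginSverak2002, §2 p. 94; LemarieRieusset2002, ch. 32–33] -/
theorem slicedLinearLEIUnderRate_holds : SlicedLinearLEIUnderRate := by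
  obtain ⟨Mz, hMz, hM⟩ := exists_winCutoff_deriv_bound
  obtain ⟨C₁, C₂, hC₁, hC₂, hP⟩ := exists_pressurePairing_le_linear (r := 3) (by norm_num)
  obtain ⟨V₁, hV₁⟩ : ∃ V : ℝ≥0∞, V = volume (ball (0 : EuclideanSpace ℝ (Fin 3)) 1) := ⟨_, rfl⟩
  have hVt : V₁ ≠ ⊤ := hV₁ ▸ measure_ball_lt_top.ne
  refine ⟨2 * V₁, linkWeight₁ Mz, linkWeight₂ Mz C₁ C₂, ENNReal.mul_ne_top (by norm_num) hVt,
    ENNReal.mul_ne_top (by norm_num) ENNReal.ofReal_ne_top,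
    ENNReal.mul_ne_top ENNReal.ofReal_ne_top (by
      refine ENNReal.add_ne_top.2 ⟨by norm_num, ENNReal.mul_ne_top (by norm_num) ?_⟩
      exact ENNReal.add_ne_top.2 ⟨ENNReal.mul_ne_top (by norm_num) hC₁, hC₂⟩), ?_⟩
  intro M T u p hM0 hT hcl hLH hrate y t ht1 htT
  have hT0 : 0 < T := by linarith
  have ht0 : 0 < t := by linarith
  by_cases hreg : t ≤ T - 1 / 2
  · -- the trivial regime `T − t ≥ 1/2`: the rate alone
    have hpt : ∀ x, ‖u t x‖ₑ ^ 2 ≤ ENNReal.ofReal (2 * M ^ 2) := by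
      intro x
      have h1 := hrate t ⟨ht0, htT⟩ x
      have hTt : 1 / 2 ≤ T - t := by linarith
      have hsq : 0 < Real.sqrt (T - t) := Real.sqrt_pos.2 (by linarith)
      have h2 : ‖u t x‖ ^ 2 ≤ 2 * M ^ 2 := by
        calc ‖u t x‖ ^ 2 ≤ (M / Real.sqrt (T - t)) ^ 2 := pow_le_pow_left₀ (norm_nonneg _) h1 2
          _ = M ^ 2 / (T - t) := by rw [div_pow, Real.sq_sqrt (by linarith)]
          _ ≤ 2 * M ^ 2 := by
              rw [div_le_iff₀ (by linarith)]; nlinarith [sq_nonneg M]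
      rw [← ofReal_norm, ← ENNReal.ofReal_pow (norm_nonneg _)]
      exact ENNReal.ofReal_le_ofReal h2
    refine le_add_right ?_
    calc ∫⁻ x in ball y 1, ‖u t x‖ₑ ^ 2 ≤ ∫⁻ x in ball y 1, ENNReal.ofReal (2 * M ^ 2) :=
          lintegral_mono fun x => hpt x
      _ = ENNReal.ofReal (2 * M ^ 2) * V₁ := by
          rw [setLIntegral_const, Measure.addHaar_ball_center, hV₁]
      _ = 2 * V₁ * ENNReal.ofReal (M ^ 2) := by
          rw [ENNReal.ofReal_mul (by norm_num : (0 : ℝ) ≤ 2), ENNReal.ofReal_ofNat]; ring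
      _ ≤ 2 * V₁ * ENNReal.ofReal (M ^ 2 + M ^ 3) :=
          mul_le_mul' le_rfl (ENNReal.ofReal_le_ofReal (le_add_of_nonneg_right (pow_nonneg hM0 3)))
  · -- the LEI regime `T − 1/2 < t < T`
    rw [not_le] at hreg
    refine le_add_left ?_
    obtain ⟨hsw, hu3, hfu⟩ := suitableData_of_classical hcl
    obtain ⟨G, hG, -⟩ := hLH.exists_hasWeakSpatialGradientOn
    have hζ := isSpaceTimeTestOn_winCutoffAt T y
    have hζQ : ∀ τ < T, tsupport (uncurry (winCutoffAt T y)) ∩ {z | z.1 ≤ τ} ⊆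
        ((slab (EuclideanSpace ℝ (Fin 3)) (Ioo 0 T) isOpen_Ioo : TopologicalSpace.Opens _) :
          Set (ℝ × EuclideanSpace ℝ (Fin 3))) := by
      intro τ hτ z hz
      rw [coe_slab]
      have h1 := (tsupport_winCutoffAt_subset T y hz.1).1
      have h2 : z.1 ≤ τ := hz.2
      exact ⟨⟨by linarith, by linarith⟩, mem_univ _⟩
    have hLEI := hsw.ae_localEnergy_slice_ennreal_of_forall_lt hG hu3 hfu hζ
      (fun s x => (winCutoffAt_nonneg_le_one T y s x).1) zero_le_one (T := T) hζQ
    refine le_of_ae_le_of_continuousOn (a := T - 1 / 2) hreg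
      (F := fun s => ∫⁻ x in ball y 1, ‖u s x‖ₑ ^ 2)
      (G := fun s => ∫⁻ σ in Ioo (T - 1) s, (linkWeight₁ Mz + linkWeight₂ Mz C₁ C₂ *
        ENNReal.ofReal (M / Real.sqrt (T - σ))) * ulocEnergy (u σ))
      (continuousOn_setLIntegral_ball hcl.smooth_velocity (by linarith) hreg.le htT y)
      (fun s₁ s₂ h => lintegral_mono_set (Ioo_subset_Ioo_right h)) ?_
    filter_upwards [hLEI] with s hs hsI
    have hsT : s < T := hsI.2.trans htT
    calc ∫⁻ x in ball y 1, ‖u s x‖ₑ ^ 2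
        = ∫⁻ x in ball y 1, ‖u s x‖ₑ ^ 2 * ENNReal.ofReal (winCutoffAt T y s x) :=
          setLIntegral_congr_fun measurableSet_ball fun x hx => by
            rw [winCutoffAt_eq_one ⟨hsI.1.le, by linarith⟩
              (by rw [mem_ball, dist_eq_norm] at hx; exact hx.le), ENNReal.ofReal_one, mul_one]
      _ ≤ ∫⁻ x, ‖u s x‖ₑ ^ 2 * ENNReal.ofReal (winCutoffAt T y s x) := setLIntegral_le_lintegral _ _
      _ ≤ (∫⁻ x, ‖u s x‖ₑ ^ 2 * ENNReal.ofReal (winCutoffAt T y s x)) +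
            ENNReal.ofReal (2 * 1) * ∫⁻ z in {z : ℝ × EuclideanSpace ℝ (Fin 3) | z.1 < s},
              ENNReal.ofReal (frobeniusNormSq (G z.1 z.2)) * ENNReal.ofReal (winCutoffAt T y z.1 z.2) :=
          le_self_add
      _ ≤ ENNReal.ofReal (∫ z in {z : ℝ × EuclideanSpace ℝ (Fin 3) | z.1 < s},
            localEnergyRHS 1 0 u p (winCutoffAt T y) z) := hs hsT
      _ ≤ _ := ofReal_integral_localEnergyRHS_le hM hP hM0 hT hcl hLH hrate y hsT

end Summit.NavierStokesRegularity.NavierStokesRegularity.Theorems.StrainDoors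

end
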